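import Summits.BirchSwinnertonDyer.Rank1Residual.P2.PrintCf2DeuringGaloisSummandAvatar
import Summits.BirchSwinnertonDyer.BirchSwinnertonDyer.Theorems.PrintCf2SplitBadTwoCMPrimaryModule
import Literature.NumberTheory.GaloisRepresentations.CocyclicScalarCharacter
import HarnessLib

set_option autoImplicit false

/-!
# Crux `PrintCf2.SplitBadTwoRankOneOfFacts` (stmt-BirchSwinnertonDyer-20368), road α v10.3, S3b′ TWIST step:
# THE SCALAR CHARACTER `ψ_{W*}` OF THE PINNED SUMMAND AT FROBENIUS AND AT INERTIA — `ψ_{W*}(Frob_w) = ι⁻¹((ψ∘c)(ϖ_w))`,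
# `ψ_{W*}(I_w) = 1` at unramified `w ≠ v̄`, `ψ_{W*}(I_w) ⊆ {±1}` at every `w ≠ v̄`, hence `ψ_{W*}` read in `ℚ̄₂`
# IS a `2`-adic avatar of `λ = (ψ∘c)⁻¹` — `IsPAdicAvatarOf ι (galConj c ψ)⁻¹` (granted the print)

Cell `bsd-print-cf2`, typer seat ty2 g30 (the DISCHARGE INTERFACE, `P2/` = the typer's Summits-side files),
serving crux stmt-BirchSwinnertonDyer-20368 (`Theorems/PrintCf2SplitBadTwo*`). HONEST FRAMING: THEOREMS ONLY
(no definition, no named fact, no `sorry`); the Literature named fact `Deuring_galoisAction_cmPrimaryTorsion_split`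
(p667198, statement-only, Rubin LNM 1716 Thm. 5.15 / Cor. 5.16 AS PRINTED) is the displayed HYPOTHESIS `hD`;
nothing here closes a crux or a stub; BSD is not proved by any of this; beyond-print theorem: no.

WHAT. The width memo `Cruxes/SplitBadTwoRankOneOfFacts/S3B-TWIST-RECIPE-w5g2.md` §2 consumes (D-Gal) as
«`ψ_{W*}` of (ii) (p664116 `CocyclicScalar.exists_continuousMonoidHom_forall_smul_eq`) IS the `ℤ₂ˣ`-valued avatar
of `λ = (ψ∘c)⁻¹`». Files `PrintCf2DeuringGaloisSummand.lean` (p670251) and `…Avatar.lean` (p671246) give the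
level-wise integer scalars of Frobenius on `W* = ↥((W.baseChange K).endEigenPrimaryTorsion 2 π r₀)` and their
`ι`-reading `N ≡ z = ι⁻¹((ψ∘c)(ϖ_w)) (mod 2ᵏ ℤ₂)`. THIS FILE reads them on ANY function `ψW : Γ_K → ℤ₂ˣ` through
which `Γ_K` acts levelwise on `W*` (`σ • x = (ψW σ mod 2ᵏ) • x` for `2ᵏ x = 0` — the currency of p664116 and of
-w5's `FiniteTwist.exists_twistData_of_scalarChar_two`), in the v10 frame with `ι` inducing `v` (`hι`):

* `unitsChar_coe_eq_symm_valueAtUniformizer_galConj_of_pinned` — **`ψW σ = ι⁻¹((HeckeCharacter.galConj c ψ)(ϖ_w))`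
  in `ℚ̄₂`** for every arithmetic Frobenius `σ` at a prime above a finite `w ≠ v̄` at which `ψ` is unramified
  (`= (ι⁻¹(λ(ϖ_w)))⁻¹`, the arithmetic-Frobenius eigenvalue `IsPAdicAvatarOf ι λ r` prescribes;
  `DeuringGaloisSummandAvatar.symm_valueAtUniformizer_inv_galConj_inv`);
* `unitsChar_eq_one_of_inertia_of_pinned` — `ψW τ = 1` for `τ` in the inertia group of a prime above such a `w`;
* `unitsChar_eq_one_or_eq_neg_one_of_inertia_of_pinned` — `ψW τ = ±1` for `τ` in the inertia group of a prime
  above ANY `w ≠ v̄` (so `ψW·θ̂` is unramified at `w ∣ 7d` once `θ̂|_{I_w} = ψW|_{I_w}`, the memo's last clause).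
* **`exists_isPAdicAvatarOf_galConj_inv_of_pinned`** — for CONTINUOUS `ψW : Γ_K →ₜ* ℤ₂ˣ`: the rank-one framed
  representation `σ ↦ (ψW σ)` over `ℚ̄₂` satisfies **`IsPAdicAvatarOf ι (HeckeCharacter.galConj c ψ)⁻¹`** —
  «`ψ_{W*}` IS the avatar of `λ = (ψ∘c)⁻¹`», the memo's use of (D-Gal), as a theorem granted the print.
The first three read `ψW` at an element of order `2ᵏ` of `W*` (-w2 `CMPrimes.endEigenPrimaryTorsion_two_structure`) with
`CocyclicScalar.toZModPow_unitsChar_eq_of_smul_eq`.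

What this does NOT do: identify `ψW` with a GIVEN avatar `r` of `λ` (rigidity of rank-one avatars, -w4's
`AvatarRigidity`), build `ψW` (p664116 does), treat `w = v̄`, or prove the print. presearch: not applicable
(bookkeeping over tree theorems; no stub or fact filed).

References: K. Rubin, LNM 1716 (1999), §5 Thm. 5.15, Cor. 5.16; [SerreAbelianLadic1968] Ch. I §1.2, Ch. II §2.7;
[SilvermanATAEC1994] Ch. II Thm. 9.2.
-/

noncomputable section

open scoped Classical
open NumberField IsDedekindDomain WeierstrassCurve Field
open Literature.NumberTheory.EllipticCurves Literature.NumberTheory.GaloisRepresentations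
open Summit.BirchSwinnertonDyer.BirchSwinnertonDyer.Theorems.PrintCf2

namespace Summit.BirchSwinnertonDyer.Rank1Residual.P2.DeuringGaloisSummandCharacter

open Summit.BirchSwinnertonDyer.BirchSwinnertonDyer.Theorems.RamifiedSevenEllipticUnits
open DeuringGaloisSummandAvatar

variable {K : Type} [Field K] [NumberField K]
variable {d : ℤ} {W : WeierstrassCurve ℚ} [W.IsElliptic] [W.IsGloballyMinimal] {C : VariableChange ℚ}
  {v vbar : HeightOneSpectrum (𝓞 K)} {ψ : HeckeCharacter K}

/-- **`ψ_{W*}(Frob_w) = ι⁻¹((ψ∘c)(ϖ_w))`.** Granted the print `hD`: in every v10 frame with `ι` inducing `v`, for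
ANY function `ψW : Γ_K → ℤ₂ˣ` through which `Γ_K` acts levelwise on the pinned summand
`W* = ↥((W.baseChange K).endEigenPrimaryTorsion 2 π r₀)` (the currency of p664116
`CocyclicScalar.exists_continuousMonoidHom_forall_smul_eq`: `σ • x = (ψW σ mod 2ᵏ) • x` for `2ᵏ x = 0`), every
arithmetic Frobenius `σ` at a prime above a finite `w ≠ v̄` at which `ψ` is unramified has
`ψW σ = ι⁻¹((HeckeCharacter.galConj c ψ).valueAtUniformizer w)` read in `ℚ̄₂` — the arithmetic-Frobenius
eigenvalue `(ι⁻¹(λ(ϖ_w)))⁻¹` of the avatar of `λ = (ψ∘c)⁻¹` (`symm_valueAtUniformizer_inv_galConj_inv`). Proof: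
`ψW σ ≡ N ≡ z (mod 2ᵏ)` at every level, read at an element of order `2ᵏ` of `W*`
(-w2 `CMPrimes.endEigenPrimaryTorsion_two_structure`). [cite: Rubin1999, §5 Cor. 5.16 (ii)]
[cite: SerreAbelianLadic1968, Ch. I §1.2 and Ch. II §2.7] -/
theorem unitsChar_coe_eq_symm_valueAtUniformizer_galConj_of_pinned
    (hD : Deuring_galoisAction_cmPrimaryTorsion_split)
    (hd0 : d ≠ 0) (hC : C • W = cm7.quadraticTwist (d : ℚ)) (hK : IsImaginaryQuadratic K)
    (hv : ((2 : ℕ) : 𝓞 K) ∈ v.asIdeal) (hvbar : ((2 : ℕ) : 𝓞 K) ∈ vbar.asIdeal) (hne : vbar ≠ v)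
    (ι : PadicAlgCl 2 ≃+* ℂ)
    (hι : ∀ (wi : InfinitePlace K) (k : 𝓞 K), k ∈ v.asIdeal ↔ ‖ι.symm (wi.embedding (k : K))‖ < 1)
    (c : K ≃ₐ[ℚ] K) (hc : c ≠ 1) (hψ : ψ.HasInfinityType (fun _ ↦ 1) (fun _ ↦ 0))
    (hL : ∀ s : ℂ, 3 / 2 < s.re → heckeLFunction ψ s = W.LSeries s)
    (π : (W.baseChange K).endRing) (hrel : (π : AddMonoid.End (W.baseChange K).geomPoints) * π = π - 2)
    {r₀ : ℤ_[2]} (hr₀ : r₀ * r₀ = r₀ - 2)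
    (hpin : ∀ τ ∈ GreenbergSelmer.inertia v,
      ∀ x : ↥((W.baseChange K).endEigenPrimaryTorsion 2 π r₀), τ • x = x ∨ τ • x = -x)
    {ψW : absoluteGaloisGroup K → ℤ_[2]ˣ}
    (hψW : ∀ (σ : absoluteGaloisGroup K) (k : ℕ) (x : ↥((W.baseChange K).endEigenPrimaryTorsion 2 π r₀)),
      2 ^ k • x = 0 → σ • x = (PadicInt.toZModPow k (ψW σ : ℤ_[2])).val • x)
    {w : HeightOneSpectrum (𝓞 K)} (hw : w ≠ vbar) (hunr : ψ.IsUnramifiedAt w)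
    {𝔔 : Ideal (absIntegers (𝓞 K) K)} (h𝔔 : 𝔔 ∈ w.primesAbove)
    {σ : absoluteGaloisGroup K} (hσ : IsArithFrobAt (𝓞 K) σ 𝔔) :
    (((ψW σ : ℤ_[2]) : ℚ_[2]) : PadicAlgCl 2) = ι.symm ((HeckeCharacter.galConj c ψ).valueAtUniformizer w) := by
  haveI : Fact (Nat.Prime 2) := ⟨Nat.prime_two⟩
  obtain ⟨z, hz, hact⟩ := exists_padicInt_smul_eq_of_isArithFrobAt_of_pinned hD hd0 hC hK hv hvbar hne ι hι c hc
    hψ hL π hrel hr₀ hpin hw hunr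
  -- full levels of `W*` (-w2)
  obtain ⟨hj, -, -, -, -⟩ := FramePinning.cm_data_of_smul_eq_cm7Twist W hd0 hC
  obtain ⟨⟨θ, hθ⟩, -⟩ := FramePinning.exists_sq_eq_neg_seven_of_frame hd0 W hC hK hv hvbar hne hL
  obtain ⟨-, -, -, -, -, -, hgen, -⟩ := CMPrimes.endEigenPrimaryTorsion_two_structure W hj K hθ π hrel hr₀
  have hzeq : (ψW σ : ℤ_[2]) = z := by
    refine PadicInt.ext_of_toZModPow.mp fun k ↦ ?_
    obtain ⟨g, hg, hord, -⟩ := hgen k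
    have hx : addOrderOf (⟨g, hg⟩ : ↥((W.baseChange K).endEigenPrimaryTorsion 2 π r₀)) = 2 ^ k := by
      rw [← hord]
      exact (addOrderOf_injective ((W.baseChange K).endEigenPrimaryTorsion 2 π r₀).subtype
        Subtype.coe_injective ⟨g, hg⟩).symm
    obtain ⟨⟨N, hN, hNact⟩, -⟩ := hact 𝔔 h𝔔 σ hσ k
    have h1 : PadicInt.toZModPow k (ψW σ : ℤ_[2]) = N :=
      CocyclicScalar.toZModPow_unitsChar_eq_of_smul_eq hψW hx
        (hNact _ (CocyclicScalar.pow_nsmul_eq_zero_of_addOrderOf hx))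
    have h2 : PadicInt.toZModPow k ((N : ℤ_[2]) - z) = 0 := by
      rw [← RingHom.mem_ker, PadicInt.ker_toZModPow]
      simpa using hN
    rw [map_sub, map_intCast, sub_eq_zero] at h2
    rw [h1, h2]
  rw [hzeq, hz]

/-- **`ψ_{W*}(I_w) = 1` at an unramified `w ≠ v̄`** for any levelwise scalar function `ψW` of the pinned summand
(inertia acts trivially, `DeuringGaloisSummand.smul_eq_self_of_inertia_of_pinned`, read at elements of every
order `2ᵏ`). [cite: Rubin1999, §5 Thm. 5.15 (ii)–(iii)] [cite: SerreAbelianLadic1968, Ch. I §1.2] -/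
theorem unitsChar_eq_one_of_inertia_of_pinned
    (hD : Deuring_galoisAction_cmPrimaryTorsion_split)
    (hd0 : d ≠ 0) (hC : C • W = cm7.quadraticTwist (d : ℚ)) (hK : IsImaginaryQuadratic K)
    (hv : ((2 : ℕ) : 𝓞 K) ∈ v.asIdeal) (hvbar : ((2 : ℕ) : 𝓞 K) ∈ vbar.asIdeal) (hne : vbar ≠ v)
    (c : K ≃ₐ[ℚ] K) (hc : c ≠ 1) (hψ : ψ.HasInfinityType (fun _ ↦ 1) (fun _ ↦ 0))
    (hL : ∀ s : ℂ, 3 / 2 < s.re → heckeLFunction ψ s = W.LSeries s)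
    (π : (W.baseChange K).endRing) (hrel : (π : AddMonoid.End (W.baseChange K).geomPoints) * π = π - 2)
    {r₀ : ℤ_[2]} (hr₀ : r₀ * r₀ = r₀ - 2)
    (hpin : ∀ τ ∈ GreenbergSelmer.inertia v,
      ∀ x : ↥((W.baseChange K).endEigenPrimaryTorsion 2 π r₀), τ • x = x ∨ τ • x = -x)
    {ψW : absoluteGaloisGroup K → ℤ_[2]ˣ}
    (hψW : ∀ (σ : absoluteGaloisGroup K) (k : ℕ) (x : ↥((W.baseChange K).endEigenPrimaryTorsion 2 π r₀)),
      2 ^ k • x = 0 → σ • x = (PadicInt.toZModPow k (ψW σ : ℤ_[2])).val • x)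
    {w : HeightOneSpectrum (𝓞 K)} (hw : w ≠ vbar) (hunr : ψ.IsUnramifiedAt w)
    {𝔔 : Ideal (absIntegers (𝓞 K) K)} (h𝔔 : 𝔔 ∈ w.primesAbove)
    {τ : absoluteGaloisGroup K} (hτ : τ ∈ 𝔔.inertia (absoluteGaloisGroup K)) : ψW τ = 1 := by
  haveI : Fact (Nat.Prime 2) := ⟨Nat.prime_two⟩
  obtain ⟨hj, -, -, -, -⟩ := FramePinning.cm_data_of_smul_eq_cm7Twist W hd0 hC
  obtain ⟨⟨θ, hθ⟩, -⟩ := FramePinning.exists_sq_eq_neg_seven_of_frame hd0 W hC hK hv hvbar hne hL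
  obtain ⟨-, -, -, -, -, -, hgen, -⟩ := CMPrimes.endEigenPrimaryTorsion_two_structure W hj K hθ π hrel hr₀
  apply Units.ext
  refine PadicInt.ext_of_toZModPow.mp fun k ↦ ?_
  obtain ⟨g, hg, hord, -⟩ := hgen k
  have hx : addOrderOf (⟨g, hg⟩ : ↥((W.baseChange K).endEigenPrimaryTorsion 2 π r₀)) = 2 ^ k := by
    rw [← hord]
    exact (addOrderOf_injective ((W.baseChange K).endEigenPrimaryTorsion 2 π r₀).subtype
      Subtype.coe_injective ⟨g, hg⟩).symm
  have hfix := DeuringGaloisSummand.smul_eq_self_of_inertia_of_pinned hD hd0 hC hK hv hvbar hne c hc hψ hL π hrel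
    hr₀ hpin hw hunr h𝔔 hτ ⟨g, hg⟩
  have h1 : PadicInt.toZModPow k (ψW τ : ℤ_[2]) = (1 : ℤ) :=
    CocyclicScalar.toZModPow_unitsChar_eq_of_smul_eq hψW hx (by rw [one_zsmul]; exact hfix)
  rw [h1, Units.val_one, map_one, Int.cast_one]

/-- **`ψ_{W*}(I_w) ⊆ {±1}` at EVERY `w ≠ v̄`** (ramified or not: the places above `7`, the odd primes dividing
`d`, and `v`) for any levelwise scalar function `ψW` of the pinned summand — inertia acts uniformly as `+1` or
as `−1` (`DeuringGaloisSummand.smul_eq_self_or_eq_neg_of_inertia_of_pinned`). [cite: Rubin1999, §5 Thm. 5.15 (i)–(ii)]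
[cite: SerreAbelianLadic1968, Ch. I §1.2] -/
theorem unitsChar_eq_one_or_eq_neg_one_of_inertia_of_pinned
    (hD : Deuring_galoisAction_cmPrimaryTorsion_split)
    (hd0 : d ≠ 0) (hC : C • W = cm7.quadraticTwist (d : ℚ)) (hK : IsImaginaryQuadratic K)
    (hv : ((2 : ℕ) : 𝓞 K) ∈ v.asIdeal) (hvbar : ((2 : ℕ) : 𝓞 K) ∈ vbar.asIdeal) (hne : vbar ≠ v)
    (c : K ≃ₐ[ℚ] K) (hc : c ≠ 1) (hψ : ψ.HasInfinityType (fun _ ↦ 1) (fun _ ↦ 0))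
    (hL : ∀ s : ℂ, 3 / 2 < s.re → heckeLFunction ψ s = W.LSeries s)
    (π : (W.baseChange K).endRing) (hrel : (π : AddMonoid.End (W.baseChange K).geomPoints) * π = π - 2)
    {r₀ : ℤ_[2]} (hr₀ : r₀ * r₀ = r₀ - 2)
    (hpin : ∀ τ ∈ GreenbergSelmer.inertia v,
      ∀ x : ↥((W.baseChange K).endEigenPrimaryTorsion 2 π r₀), τ • x = x ∨ τ • x = -x)
    {ψW : absoluteGaloisGroup K → ℤ_[2]ˣ}
    (hψW : ∀ (σ : absoluteGaloisGroup K) (k : ℕ) (x : ↥((W.baseChange K).endEigenPrimaryTorsion 2 π r₀)),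
      2 ^ k • x = 0 → σ • x = (PadicInt.toZModPow k (ψW σ : ℤ_[2])).val • x)
    {w : HeightOneSpectrum (𝓞 K)} (hw : w ≠ vbar)
    {𝔔 : Ideal (absIntegers (𝓞 K) K)} (h𝔔 : 𝔔 ∈ w.primesAbove)
    {τ : absoluteGaloisGroup K} (hτ : τ ∈ 𝔔.inertia (absoluteGaloisGroup K)) : ψW τ = 1 ∨ ψW τ = -1 := by
  haveI : Fact (Nat.Prime 2) := ⟨Nat.prime_two⟩
  obtain ⟨hj, -, -, -, -⟩ := FramePinning.cm_data_of_smul_eq_cm7Twist W hd0 hC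
  obtain ⟨⟨θ, hθ⟩, -⟩ := FramePinning.exists_sq_eq_neg_seven_of_frame hd0 W hC hK hv hvbar hne hL
  obtain ⟨-, -, -, -, -, -, hgen, -⟩ := CMPrimes.endEigenPrimaryTorsion_two_structure W hj K hθ π hrel hr₀
  have hx : ∀ k : ℕ, ∃ x : ↥((W.baseChange K).endEigenPrimaryTorsion 2 π r₀), addOrderOf x = 2 ^ k := by
    intro k
    obtain ⟨g, hg, hord, -⟩ := hgen k
    refine ⟨⟨g, hg⟩, ?_⟩
    rw [← hord]
    exact (addOrderOf_injective ((W.baseChange K).endEigenPrimaryTorsion 2 π r₀).subtype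
      Subtype.coe_injective ⟨g, hg⟩).symm
  rcases DeuringGaloisSummand.smul_eq_self_or_eq_neg_of_inertia_of_pinned hD hd0 hC hK hv hvbar hne c hc hψ hL π
      hrel hr₀ hpin hw h𝔔 hτ with hfix | hneg
  · left
    apply Units.ext
    refine PadicInt.ext_of_toZModPow.mp fun k ↦ ?_
    obtain ⟨x, hxk⟩ := hx k
    have h1 : PadicInt.toZModPow k (ψW τ : ℤ_[2]) = (1 : ℤ) :=
      CocyclicScalar.toZModPow_unitsChar_eq_of_smul_eq hψW hxk (by rw [one_zsmul]; exact hfix x)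
    rw [h1, Units.val_one, map_one, Int.cast_one]
  · right
    apply Units.ext
    refine PadicInt.ext_of_toZModPow.mp fun k ↦ ?_
    obtain ⟨x, hxk⟩ := hx k
    have h1 : PadicInt.toZModPow k (ψW τ : ℤ_[2]) = (-1 : ℤ) :=
      CocyclicScalar.toZModPow_unitsChar_eq_of_smul_eq hψW hxk (by rw [neg_one_zsmul]; exact hneg x)
    rw [h1, Units.val_neg, Units.val_one, map_neg, map_one, Int.cast_neg, Int.cast_one]

/-! ## `ψ_{W*}` read in `ℚ̄₂` IS a `2`-adic avatar of `λ = (ψ∘c)⁻¹` -/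

/-- **`ψ_{W*}` read in `ℚ̄₂` IS a `2`-adic avatar of `λ = (ψ∘c)⁻¹`** (the memo's «with (D-Gal): `ψ_{W*}`
of (ii) IS the `ℤ₂ˣ`-valued avatar of `λ`»). Granted the print `hD`: in every v10 frame with `ι` inducing
`v` (`hι`), for every CONTINUOUS `ψW : Γ_K →ₜ* ℤ₂ˣ` through which `Γ_K` acts levelwise on the pinned summand
`W* = ↥((W.baseChange K).endEigenPrimaryTorsion 2 π r₀)` (p664116), the rank-one framed representation
`σ ↦ (ψW σ)` over `ℚ̄₂` (entries `ψW σ` through `ℤ₂ ⊂ ℚ₂ ⊂ ℚ̄₂`; `FramedRep.unitsContinuousMulEquivOfUnique`)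
satisfies `IsPAdicAvatarOf ι (HeckeCharacter.galConj c ψ)⁻¹`: at every `w ∤ 2` with `λ` unramified at `w`
(iff `ψ` is: conj-equivariance, `DeuringShape.isHeckeConjEquivariant_of_pinned`), it is unramified
(`unitsChar_eq_one_of_inertia_of_pinned`) and every arithmetic Frobenius has characteristic polynomial
`X − C (ι⁻¹(λ(ϖ_w)))⁻¹ = X − C ι⁻¹((ψ∘c)(ϖ_w))` (`unitsChar_coe_eq_symm_valueAtUniformizer_galConj_of_pinned`,
`DeuringGaloisSummandAvatar.symm_valueAtUniformizer_inv_galConj_inv`). By -w4's rigidity of rank-one avatars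
this pins `ψW` among avatars; nothing here proves the print. [cite: Rubin1999, §5 Thm. 5.15 (ii), Cor. 5.16 (ii)]
[cite: SerreAbelianLadic1968, Ch. II §2.7] [cite: CastellaHsieh2018, §3.3 (p. 9)] -/
theorem exists_isPAdicAvatarOf_galConj_inv_of_pinned
    (hD : Deuring_galoisAction_cmPrimaryTorsion_split)
    (hd0 : d ≠ 0) (hC : C • W = cm7.quadraticTwist (d : ℚ)) (hK : IsImaginaryQuadratic K)
    (hv : ((2 : ℕ) : 𝓞 K) ∈ v.asIdeal) (hvbar : ((2 : ℕ) : 𝓞 K) ∈ vbar.asIdeal) (hne : vbar ≠ v)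
    (ι : PadicAlgCl 2 ≃+* ℂ)
    (hι : ∀ (wi : InfinitePlace K) (k : 𝓞 K), k ∈ v.asIdeal ↔ ‖ι.symm (wi.embedding (k : K))‖ < 1)
    (c : K ≃ₐ[ℚ] K) (hc : c ≠ 1) (hψ : ψ.HasInfinityType (fun _ ↦ 1) (fun _ ↦ 0))
    (hL : ∀ s : ℂ, 3 / 2 < s.re → heckeLFunction ψ s = W.LSeries s)
    (π : (W.baseChange K).endRing) (hrel : (π : AddMonoid.End (W.baseChange K).geomPoints) * π = π - 2)
    {r₀ : ℤ_[2]} (hr₀ : r₀ * r₀ = r₀ - 2)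
    (hpin : ∀ τ ∈ GreenbergSelmer.inertia v,
      ∀ x : ↥((W.baseChange K).endEigenPrimaryTorsion 2 π r₀), τ • x = x ∨ τ • x = -x)
    (ψW : absoluteGaloisGroup K →ₜ* ℤ_[2]ˣ)
    (hψW : ∀ (σ : absoluteGaloisGroup K) (k : ℕ) (x : ↥((W.baseChange K).endEigenPrimaryTorsion 2 π r₀)),
      2 ^ k • x = 0 → σ • x = (PadicInt.toZModPow k (ψW σ : ℤ_[2])).val • x) :
    ∃ r : FramedGaloisRep K (PadicAlgCl 2) 1,
      (∀ (σ : absoluteGaloisGroup K) (i j : Fin 1),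
        ((r σ : GL (Fin 1) (PadicAlgCl 2)) : Matrix (Fin 1) (Fin 1) (PadicAlgCl 2)) i j =
          (((ψW σ : ℤ_[2]) : ℚ_[2]) : PadicAlgCl 2)) ∧
      IsPAdicAvatarOf ι (HeckeCharacter.galConj c ψ)⁻¹ r := by
  haveI : Fact (Nat.Prime 2) := ⟨Nat.prime_two⟩
  set jr : ℤ_[2] →+* PadicAlgCl 2 := (algebraMap ℚ_[2] (PadicAlgCl 2)).comp PadicInt.Coe.ringHom with hjr
  have hjr_apply : ∀ x : ℤ_[2], jr x = ((x : ℚ_[2]) : PadicAlgCl 2) := fun x ↦ rfl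
  have hjc : Continuous jr := (continuous_algebraMap ℚ_[2] (PadicAlgCl 2)).comp continuous_subtype_val
  let χ' : absoluteGaloisGroup K →ₜ* (PadicAlgCl 2)ˣ :=
    ⟨(Units.map (jr : ℤ_[2] →* PadicAlgCl 2)).comp ψW.toMonoidHom,
      (Continuous.units_map (jr : ℤ_[2] →* PadicAlgCl 2) hjc).comp ψW.continuous⟩
  have hχ' : ∀ σ, ((χ' σ : (PadicAlgCl 2)ˣ) : PadicAlgCl 2) = jr (ψW σ : ℤ_[2]) := fun σ ↦ rfl
  let r : FramedGaloisRep K (PadicAlgCl 2) 1 :=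
    (FramedRep.unitsContinuousMulEquivOfUnique (Fin 1) (PadicAlgCl 2) :
      (PadicAlgCl 2)ˣ →ₜ* GL (Fin 1) (PadicAlgCl 2)).comp χ'
  have hrσ : ∀ σ, r σ = FramedRep.unitsContinuousMulEquivOfUnique (Fin 1) (PadicAlgCl 2) (χ' σ) :=
    fun σ ↦ rfl
  have hr : ∀ (σ : absoluteGaloisGroup K) (i j : Fin 1),
      ((r σ : GL (Fin 1) (PadicAlgCl 2)) : Matrix (Fin 1) (Fin 1) (PadicAlgCl 2)) i j = jr (ψW σ : ℤ_[2]) :=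
    fun σ i j ↦ by rw [hrσ, FramedRep.unitsContinuousMulEquivOfUnique_apply_coe, hχ']
  have heqv : IsHeckeConjEquivariant c ψ := DeuringShape.isHeckeConjEquivariant_of_pinned hK c hc hψ W (3 / 2) hL
  refine ⟨r, fun σ i j ↦ (hr σ i j).trans (hjr_apply _), fun w hw2 hunrl ↦ ?_⟩
  have hunr : ψ.IsUnramifiedAt w :=
    (heqv.isUnramifiedAt_galConj_iff' w).mp (HeckeCharacter.isUnramifiedAt_inv_iff.mp hunrl)
  have hwv : w ≠ vbar := by
    rintro rfl
    exact hw2 hvbar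
  refine ⟨fun 𝔔 h𝔔 τ hτ ↦ ?_, fun 𝔔 h𝔔 σ hσ ↦ ?_⟩
  · -- unramified at `w`: `ψW τ = 1` on inertia
    have h1 := unitsChar_eq_one_of_inertia_of_pinned hD hd0 hC hK hv hvbar hne c hc hψ hL π hrel hr₀ hpin hψW
      hwv hunr h𝔔 hτ
    have hχ1 : χ' τ = 1 := Units.ext (by rw [hχ', h1, Units.val_one, map_one, Units.val_one])
    rw [hrσ, hχ1, map_one]
  · -- the arithmetic Frobenius has characteristic polynomial `X − C ι⁻¹((ψ∘c)(ϖ_w))`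
    rw [FramedRep.charpoly, Matrix.charpoly, Matrix.det_fin_one, Matrix.charmatrix_apply_eq, hr,
      symm_valueAtUniformizer_inv_galConj_inv, hjr_apply,
      unitsChar_coe_eq_symm_valueAtUniformizer_galConj_of_pinned hD hd0 hC hK hv hvbar hne ι hι c hc hψ hL π
        hrel hr₀ hpin hψW hwv hunr h𝔔 hσ]

end Summit.BirchSwinnertonDyer.Rank1Residual.P2.DeuringGaloisSummandCharacter

end
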